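import Literature.Computability.Complexity.ParsimoniousCookLevin
import HarnessLib

/-!
# Invariance of the MAX-SAT value under clause permutations and variable renamings

Bookkeeping for machine renderings of CNF transformations (a machine outputs the clauses of a
specified formula in its own order and with its own variable names): the MAX-SAT value
`CNF.maxSatFraction` (Arora–Barak 2009, Def. 11.1), satisfiability and exact width are invariant
under permutations of the clause list and under renamings of the variables that are injective on the
variables that occur.

* `satisfiedFraction_le_maxSatFraction`, `exists_maxSatFraction_eq` — the value is a maximum over ALL
  total assignments (the definition ranges over assignments to `φ.vars` padded by `false`);
* `maxSatFraction_perm`, `satisfiable_perm`, `isExactWidth_perm`;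
* for `CNF.rename` (of `ParsimoniousCookLevin.lean`): `satisfiedFraction_rename`, `maxSatFraction_rename_le`, `maxSatFraction_rename`
  (equality for `ρ` injective on `φ.vars`), `satisfiable_rename_iff`, `isExactWidth_rename`.

## References

* S. Arora, B. Barak, *Computational Complexity: A Modern Approach*, CUP 2009, §11.1, Def. 11.1.
-/

namespace Literature.Computability.Complexity

namespace CNF

open Finset

variable (φ : CNF ℕ)

/-! ### The value as a maximum over all assignments -/

/-- Clause values depend only on the variables of the clause. [folklore] -/
theorem clause_eval_congr' {c : Clause ℕ} {σ σ' : ℕ → Bool} (h : ∀ l ∈ c, σ l.1 = σ' l.1) : c.eval σ = c.eval σ' := by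
  unfold Clause.eval
  induction c with
  | nil => rfl
  | cons a c ih =>
    rw [List.any_cons, List.any_cons, ih fun l hl => h l (List.mem_cons_of_mem _ hl)]
    congr 1
    simp [Literal.eval, h a List.mem_cons_self]

/-- Satisfied fractions depend only on the values on `φ.vars`. [folklore] -/
theorem satisfiedFraction_congr {σ σ' : ℕ → Bool} (h : ∀ x ∈ φ.vars, σ x = σ' x) :
    φ.satisfiedFraction σ = φ.satisfiedFraction σ' := by
  unfold satisfiedFraction
  have hc : (φ.countP fun c => c.eval σ) = φ.countP fun c => c.eval σ' := by
    refine List.countP_congr fun c hc => ?_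
    rw [clause_eval_congr' fun l hl => h l.1 ?_]
    unfold CNF.vars
    rw [List.mem_toFinset, List.mem_map]
    exact ⟨l, List.mem_flatten.2 ⟨c, hc, hl⟩, rfl⟩
  rw [hc]

/-- **Every total assignment is dominated by the value.** [cite: AroraBarakCC2009, Def. 11.1] -/
theorem satisfiedFraction_le_maxSatFraction (σ : ℕ → Bool) : φ.satisfiedFraction σ ≤ φ.maxSatFraction := by
  classical
  unfold maxSatFraction
  have h := Finset.le_sup' (fun τ : φ.vars → Bool => φ.satisfiedFraction fun x => if h : x ∈ φ.vars then τ ⟨x, h⟩ else false)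
    (Finset.mem_univ fun y : φ.vars => σ y.1)
  refine le_trans (le_of_eq (φ.satisfiedFraction_congr fun x hx => ?_)) h
  simp [hx]

/-- **The value is attained.** [cite: AroraBarakCC2009, Def. 11.1] -/
theorem exists_maxSatFraction_eq : ∃ σ : ℕ → Bool, φ.maxSatFraction = φ.satisfiedFraction σ := by
  classical
  unfold maxSatFraction
  obtain ⟨τ, -, hτ⟩ := Finset.exists_mem_eq_sup' Finset.univ_nonempty
    fun τ : φ.vars → Bool => φ.satisfiedFraction fun x => if h : x ∈ φ.vars then τ ⟨x, h⟩ else false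
  exact ⟨_, hτ⟩

/-- The value is the least upper bound of the satisfied fractions. [folklore] -/
theorem maxSatFraction_le_iff {θ : ℚ} : φ.maxSatFraction ≤ θ ↔ ∀ σ : ℕ → Bool, φ.satisfiedFraction σ ≤ θ := by
  constructor
  · intro h σ; exact (φ.satisfiedFraction_le_maxSatFraction σ).trans h
  · intro h; obtain ⟨σ, hσ⟩ := φ.exists_maxSatFraction_eq; rw [hσ]; exact h σ

/-! ### Clause permutations -/

variable {φ}

/-- Satisfied fractions are invariant under permutations of the clauses. [folklore] -/
theorem satisfiedFraction_perm {ψ : CNF ℕ} (h : φ.Perm ψ) (σ : ℕ → Bool) : φ.satisfiedFraction σ = ψ.satisfiedFraction σ := by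
  unfold satisfiedFraction numClauses
  rw [h.length_eq, h.countP_eq]

/-- **The value is invariant under permutations of the clauses.** [cite: AroraBarakCC2009, Def. 11.1] -/
theorem maxSatFraction_perm {ψ : CNF ℕ} (h : φ.Perm ψ) : φ.maxSatFraction = ψ.maxSatFraction := by
  refine le_antisymm ?_ ?_
  · rw [maxSatFraction_le_iff]; intro σ; rw [satisfiedFraction_perm h]; exact ψ.satisfiedFraction_le_maxSatFraction σ
  · rw [maxSatFraction_le_iff]; intro σ; rw [← satisfiedFraction_perm h]; exact φ.satisfiedFraction_le_maxSatFraction σ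

/-- Satisfiability is invariant under permutations of the clauses. [folklore] -/
theorem satisfiable_perm {ψ : CNF ℕ} (h : φ.Perm ψ) : φ.Satisfiable ↔ ψ.Satisfiable := by
  unfold Satisfiable
  simp only [eval_eq_true_iff]
  exact ⟨fun ⟨σ, hσ⟩ => ⟨σ, fun c hc => hσ c (h.symm.mem_iff.1 hc)⟩, fun ⟨σ, hσ⟩ => ⟨σ, fun c hc => hσ c (h.mem_iff.1 hc)⟩⟩

/-- Exact width is invariant under permutations of the clauses. [folklore] -/
theorem isExactWidth_perm {ψ : CNF ℕ} (h : φ.Perm ψ) {k : ℕ} : φ.IsExactWidth k ↔ ψ.IsExactWidth k :=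
  ⟨fun hw c hc => hw c (h.symm.mem_iff.1 hc), fun hw c hc => hw c (h.mem_iff.1 hc)⟩

/-! ### Variable renamings -/

variable (φ)

/-- Clauses of a renamed formula (`CNF.rename` of `ParsimoniousCookLevin.lean`). [folklore] -/
theorem clause_eval_renLit (ρ : ℕ → ℕ) (c : Clause ℕ) (σ : ℕ → Bool) :
    Clause.eval σ (c.map (CookLevin.renLit ρ)) = Clause.eval (σ ∘ ρ) c := by
  unfold Clause.eval
  rw [List.any_map]
  rfl

/-- **Satisfied fractions under renaming**: `frac (rename ρ φ) σ = frac φ (σ ∘ ρ)`. [folklore] -/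
theorem satisfiedFraction_rename (ρ : ℕ → ℕ) (σ : ℕ → Bool) : (φ.rename ρ).satisfiedFraction σ = φ.satisfiedFraction (σ ∘ ρ) := by
  unfold satisfiedFraction numClauses CNF.rename
  rw [List.length_map, List.countP_map]
  have : ((fun c => Clause.eval σ c) ∘ fun c : Clause ℕ => c.map (CookLevin.renLit ρ)) = fun c => Clause.eval (σ ∘ ρ) c := by
    funext c; exact clause_eval_renLit ρ c σ
  rw [this]

/-- Renaming can only lower the value. [folklore] -/
theorem maxSatFraction_rename_le (ρ : ℕ → ℕ) : (φ.rename ρ).maxSatFraction ≤ φ.maxSatFraction := by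
  rw [maxSatFraction_le_iff]
  intro σ
  rw [satisfiedFraction_rename]
  exact φ.satisfiedFraction_le_maxSatFraction _

/-- **The value is invariant under renamings injective on the variables that occur.** [cite: AroraBarakCC2009, Def. 11.1] -/
theorem maxSatFraction_rename {ρ : ℕ → ℕ} (hρ : Set.InjOn ρ φ.vars) : (φ.rename ρ).maxSatFraction = φ.maxSatFraction := by
  classical
  refine le_antisymm (φ.maxSatFraction_rename_le ρ) ?_
  rw [maxSatFraction_le_iff]
  intro σ
  -- transport `σ` along a left inverse of `ρ` on `φ.vars`
  obtain ⟨g, hg⟩ : ∃ g : ℕ → ℕ, ∀ x ∈ φ.vars, g (ρ x) = x := by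
    refine ⟨Function.invFunOn ρ φ.vars, fun x hx => ?_⟩
    exact hρ (Function.invFunOn_mem ⟨x, hx, rfl⟩) hx (Function.invFunOn_eq ⟨x, hx, rfl⟩)
  have heq : φ.satisfiedFraction σ = (φ.rename ρ).satisfiedFraction (σ ∘ g) := by
    rw [satisfiedFraction_rename]
    exact φ.satisfiedFraction_congr fun x hx => by simp [hg x hx]
  rw [heq]
  exact (φ.rename ρ).satisfiedFraction_le_maxSatFraction _

/-- Satisfiability under renaming: always reflected, preserved for renamings injective on the variables. [folklore] -/
theorem satisfiable_rename_iff {ρ : ℕ → ℕ} (hρ : Set.InjOn ρ φ.vars) : (φ.rename ρ).Satisfiable ↔ φ.Satisfiable := by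
  classical
  constructor
  · rintro ⟨σ, hσ⟩; exact ⟨σ ∘ ρ, by rwa [CNF.eval_rename] at hσ⟩
  · rintro ⟨σ, hσ⟩
    obtain ⟨g, hg⟩ : ∃ g : ℕ → ℕ, ∀ x ∈ φ.vars, g (ρ x) = x := by
      refine ⟨Function.invFunOn ρ φ.vars, fun x hx => ?_⟩
      exact hρ (Function.invFunOn_mem ⟨x, hx, rfl⟩) hx (Function.invFunOn_eq ⟨x, hx, rfl⟩)
    refine ⟨σ ∘ g, ?_⟩
    rw [CNF.eval_rename]
    -- `σ ∘ g ∘ ρ` agrees with `σ` on `φ.vars`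
    rw [eval_eq_true_iff] at hσ ⊢
    intro c hc
    rw [clause_eval_congr' (σ' := σ) fun l hl => ?_]
    · exact hσ c hc
    · have hx : l.1 ∈ φ.vars := by
        unfold CNF.vars; rw [List.mem_toFinset, List.mem_map]; exact ⟨l, List.mem_flatten.2 ⟨c, hc, hl⟩, rfl⟩
      simp [hg l.1 hx]

/-- **Exact width under renamings injective on the variables.** [folklore] -/
theorem isExactWidth_rename {ρ : ℕ → ℕ} (hρ : Set.InjOn ρ φ.vars) {k : ℕ} (h : φ.IsExactWidth k) : (φ.rename ρ).IsExactWidth k := by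
  intro c' hc'
  unfold CNF.rename at hc'
  rw [List.mem_map] at hc'
  obtain ⟨c, hc, rfl⟩ := hc'
  obtain ⟨hlen, hnd⟩ := h c hc
  refine ⟨by rw [List.length_map, hlen], ?_⟩
  rw [List.map_map]
  have : (Prod.fst ∘ CookLevin.renLit ρ) = ρ ∘ Prod.fst := rfl
  rw [this, ← List.map_map]
  refine hnd.map_on fun x hx y hy hxy => hρ ?_ ?_ hxy
  · rw [List.mem_map] at hx; obtain ⟨l, hl, rfl⟩ := hx
    unfold CNF.vars; rw [mem_coe, List.mem_toFinset, List.mem_map]; exact ⟨l, List.mem_flatten.2 ⟨c, hc, hl⟩, rfl⟩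
  · rw [List.mem_map] at hy; obtain ⟨l, hl, rfl⟩ := hy
    unfold CNF.vars; rw [mem_coe, List.mem_toFinset, List.mem_map]; exact ⟨l, List.mem_flatten.2 ⟨c, hc, hl⟩, rfl⟩

end CNF

end Literature.Computability.Complexity
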